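import Summits.AtomisticToContinuum.FouriersLaw.Theorems.BondHeatUncertaintySubdiffusiveBondHeatJunctionRatioLocalityFrames

/-!
# `JunctionRatioPeeling` — file 17a: CONTACT PEELING of the relative-locality door, and the DEPTH LADDER of contact laws
# (cell `decomp-a2c`, lens-1 «grading / quantitative ladder», gen 61; beneath the door of record
# `(∀ ρ < 1, RelativeLocalityLaw ρ) ∧ EscapeInfZero ⟹ AsymptoticSeriesLaw` of files 15a/16, target 11071)

The door's profile piece `RelativeBlockLawAt … ρ L₀` (file 15a) bounds from below the first-order drop from the HOT BATH to the last site
of the end block `u` of the composite chain `[ u | L₀ | v ]` (`N = u + L₀ + v`, steady state at `(T + δ/2, T − δ/2)`):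
`(T + δ/2) − ⟨p_{u−1}²⟩ ≥ δ·(ρ·E_N/E_u − ε)` (and the mirror clause at the cold end).  That drop is the sum of
(i) the drop over the first `d + 1` sites — the CONTACT REGION of depth `d + 1` (bath ↦ site `d`), and (ii) the INTERNAL drop of the block
(site `d` ↦ site `u − 1`).  This file grades the door along the DEPTH axis `d = 0, 1, 2, …` by peeling (i) off:

* `ContactPositivityAt … d` [NFO_d] — NO FIRST-ORDER OVERSHOOT at depth `d + 1`: `(T + δ/2) − ⟨p_d²⟩ ≥ −εδ` and `⟨p_{N−1−d}²⟩ − (T − δ/2) ≥ −εδ`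
  for every long chain: to first order in `δ` no site of the contact region is hotter than the hot bath (colder than the cold bath).
  Idea class: POSITIVITY of the cross-bath kinetic response `∂⟨p_d²⟩/∂T_R ≥ 0` («cooperative response»; phonon picture: the exit
  fraction of energy injected at site `d` through the far bath is `≥ 0`) — NOT a locality statement.  Harmonic member: TRUE at every depth
  (`∂⟨p_i²⟩/∂T_R = 2γ∫G_{i,N−1}² ≥ 0`; table below).  [piece · positivity]
* `ContactShareAt … C d` [CS_d] — BOUNDED CONTACT SHARE: the same two drops are `≤ δ·(C·E_N + ε)`: the contact region of depth `d + 1` carries at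
  most `C` contact drops (`E_N·δ = j/γ + o(δ)` is the contact drop by the response identity).  Idea class: a LOCAL OHM UPPER BOUND for the
  first `d` bonds (bounded bond resistance next to the thermostat).  Harmonic member: TRUE, `C_d ↑ (1/2)/E_∞` (table).  [piece · local share]
* `PeeledBlockLawAt … ρ d L₀` [PBL] — the door's clause with the contact region PEELED: internal drop `⟨p_d²⟩ − ⟨p_{u−1}²⟩ ≥ δ·(ρ·E_N/E_u − ε)`
  (mirror at the cold end).  Idea class: bulk resistivity / locality (the door's own).  [piece · peeled door]

Seams (PROVED, bookkeeping at one small `δ` and one steady state): `relativeBlockLawAt_of_peeled : NFO_d ∧ PBL(ρ, d) ⟹ RelativeBlockLawAt ρ`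
and the CONVERSE MODULO THE CONTACT SHARE `peeled_of_relativeBlockLawAt : RelativeBlockLawAt ρ ∧ CS_d(C) ∧ (E_n → 0) ⟹ PBL(ρ', d)` for every
`ρ' < ρ` — peeling any FIXED depth is LOSSLESS up to the ratio slack: the bulk-locality content of the door is invariant under boundary
surgery (it is ATOMIC along the depth axis), and the only new content fixed-depth peeling exposes is the pair of LOCAL contact laws NFO_d / CS_d.
DEPTH LADDER («where the theorems stop»): depth 1 (`d = 0`, the bare contact) — BOTH contact laws are THEOREMS (file 17b
`…JunctionRatioPeelingDepthOne`: `contactPositivityAt_zero`, `contactShareAt_one_zero`, from the response identity 12237 + weak-NESS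
uniqueness 0741 + the contact law `j = γ(T_L − ⟨p_0²⟩)`), so `PBL(ρ, 0) ⟹ RBL(ρ) ⟹ PBL(ρ', 0)` outright (mod `E_n → 0`); depth 2 (`d = 1`, the
FIRST BOND) — both laws UNDECIDED · IDEA-NEEDED (sign and size of the first-order drop across the bond adjacent to the thermostat, N-uniformly;
the one place in the chain with a priori Fisher-information control from the entropy production) · INSTRUMENTABLE (two site temperatures) =
the next grade.  LENS FINDING (harmonic calibration, exact Lyapunov/transfer computation `decomp-a2c-lens-1/g61/calib/harmonic_profile.py`,
`TABLE-harmonic.md`; ω₂ = γ = 1, lam = β = 0, N ≤ 64, sum-rule error ≤ 6·10⁻⁸): first-order profile `φ_i = ((T+δ/2) − ⟨p_i²⟩)/δ =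
(0.1250, 0.4688, 0.4922, 0.4980, 0.4995, 0.4999, 0.5000, …)`, monotone, `E_∞ = 1/8`, contact-share constants `C_d = φ_d/E = 1, 3.75, 3.94, 3.98, → 4`;
hence the harmonic member satisfies `RelativeBlockLawAt ρ` iff `ρ < 1/2` but `PeeledBlockLawAt ρ d` iff `ρ < 1/2 − φ_d(∞) = 3/8, 1/32, 1/128,
1/512, … → 0`: PEELING MOVES THE PHONON THRESHOLD OF THE ρ-LADDER FROM 1/2 DOWN TO 0 (exponentially in the depth) — the peeled rungs
`PBL(ρ, d)`, `ρ > 0` small, `d ≥ 2`, are the weakest typed profile statements of the lineage that already exclude the ballistic member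
(«the interior of an end block carries a non-vanishing share of the drop»), while all sequence-level pay-off stays at `ρ > 1/2`
(`exponentFloor_of_relativeLocalityLaw_of_escapeInfZero`).  Anharmonic instrument data of record: census cell j337563 (`D_N`, T = 1/3/10,
N ≤ 2048, `HOME/census/data/j337563/TABLE.md`) prices `E_N = D_N/((N−1)γ)` only; NO profile column exists yet (ask: `⟨p_0²⟩, ⟨p_1²⟩, ⟨p_2²⟩` at
both ends of the standing cells = NFO_1/CS_1 directly).
Frames by name: `relativeLocalityLaw_of_peeled`, `asymptoticSeriesLaw_of_peeled_of_escapeInfZero`,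
`boundedResponse_of_peeled_of_escapeInfZero_of_subOhmicBootstrap` (11071 BY NAME), `peeledLocalityLaw_of_relativeLocalityLaw` (converse frame).
No `sorry`; standard axioms; imports only file 16 (tree).
-/

noncomputable section

open MeasureTheory Filter Topology Set
open scoped BigOperators

namespace Summit.AtomisticToContinuum.FouriersLaw.Theorems.SubdiffusiveBondHeat

namespace EscapeGrading

open Literature.MathematicalPhysics.KineticTheory.HeatConduction
open Summit.AtomisticToContinuum.FouriersLaw.Theses.BondHeatUncertainty (BoundedResponse NonBallistic)
open Summit.AtomisticToContinuum.FouriersLaw.Theorems.SubdiffusiveBondHeat.JunctionDefectGrading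

/-! ## A. The contact laws at depth `d + 1` and the peeled block law (fixed parameters and temperature) -/

/-- **No first-order overshoot at depth `d + 1`** [NFO_d] at `(ω₂, lam, β, γ, T)`: `∃ N₂, ∀ N ≥ N₂` (`N ≥ d + 1`), `∀ ε > 0`, for all small
`δ > 0` and every steady state `μ` of the `N`-chain at `(T + δ/2, T − δ/2)`: `(T + δ/2) − ⟨p_d²⟩_μ ≥ −εδ` and `⟨p_{N−1−d}²⟩_μ − (T − δ/2) ≥ −εδ`.
Tags: depth 1 (`d = 0`) PROVED (file 17b); `d ≥ 1` UNDECIDED · IDEA-NEEDED (positivity of the cross-bath kinetic response; no cooperative /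
monotone-coupling structure known for the anharmonic chain — a synchronous coupling leaves an unsigned second-variation term) · INSTRUMENTABLE ·
harmonic-TRUE at every depth. [piece · positivity] -/
def ContactPositivityAt (ω₂ lam β γ T : ℝ) (d : ℕ) : Prop :=
  ∃ N₂ : ℕ, ∀ N : ℕ, N₂ ≤ N → ∀ (_hN : d + 1 ≤ N), ∀ ε : ℝ, 0 < ε →
    ∃ δ₀ : ℝ, 0 < δ₀ ∧ ∀ δ : ℝ, 0 < δ → δ < δ₀ →
      ∀ μ : Measure (PhaseSpace N), (pinnedChain ω₂ lam β γ).IsSteadyState N (T + δ / 2) (T - δ / 2) μ →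
        -(δ * ε) ≤ (T + δ / 2) - ∫ x, x.2 ⟨d, by omega⟩ ^ 2 ∂μ ∧
        -(δ * ε) ≤ ∫ x, x.2 ⟨N - 1 - d, by omega⟩ ^ 2 ∂μ - (T - δ / 2)

/-- **Bounded contact share at depth `d + 1`** [CS_d] with constant `C` at `(ω₂, lam, β, γ, T)`: same quantifiers, and
`(T + δ/2) − ⟨p_d²⟩_μ ≤ δ·(C·E_N + ε)`, `⟨p_{N−1−d}²⟩_μ − (T − δ/2) ≤ δ·(C·E_N + ε)` (`E_N = escapeDeficit … T N`; `E_N·δ` = the contact drop to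
first order).  Tags: depth 1 PROVED with `C = 1` (file 17b); `d ≥ 1` UNDECIDED · IDEA-NEEDED (an N-uniform upper bound on the resistance of the
first `d` bonds) · INSTRUMENTABLE · harmonic-TRUE (`C_d ↑ (1/2)/E_∞`). [piece · local share] -/
def ContactShareAt (ω₂ lam β γ T C : ℝ) (d : ℕ) : Prop :=
  ∃ N₂ : ℕ, ∀ N : ℕ, N₂ ≤ N → ∀ (_hN : d + 1 ≤ N), ∀ ε : ℝ, 0 < ε →
    ∃ δ₀ : ℝ, 0 < δ₀ ∧ ∀ δ : ℝ, 0 < δ → δ < δ₀ →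
      ∀ μ : Measure (PhaseSpace N), (pinnedChain ω₂ lam β γ).IsSteadyState N (T + δ / 2) (T - δ / 2) μ →
        (T + δ / 2) - ∫ x, x.2 ⟨d, by omega⟩ ^ 2 ∂μ ≤ δ * (C * escapeDeficit ω₂ lam β γ T N + ε) ∧
        ∫ x, x.2 ⟨N - 1 - d, by omega⟩ ^ 2 ∂μ - (T - δ / 2) ≤ δ * (C * escapeDeficit ω₂ lam β γ T N + ε)

/-- **Peeled block law** [PBL] with ratio `ρ` at depth `d + 1`, buffer `L₀`, at `(ω₂, lam, β, γ, T)`: `∃ N₂, ∀ u v ≥ N₂` (`u, v ≥ d + 1`),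
`∀ ε > 0`, for all small `δ > 0` and every steady state `μ` of the `(u + L₀ + v)`-chain at `(T + δ/2, T − δ/2)`: the INTERNAL drops of the two
end blocks obey `⟨p_d²⟩_μ − ⟨p_{u−1}²⟩_μ ≥ δ·(E_N·ρ/E_u − ε)` and `⟨p_{u+L₀}²⟩_μ − ⟨p_{N−1−d}²⟩_μ ≥ δ·(E_N·ρ/E_v − ε)` — `RelativeBlockLawAt`
with the contact region of depth `d + 1` peeled off.  Tags: UNDECIDED · IDEA-NEEDED (bulk locality — the door's own class) · INSTRUMENTABLE ·
equivalent to the door modulo the contact laws (`relativeBlockLawAt_of_peeled`, `peeled_of_relativeBlockLawAt`) · harmonic-TRUE iff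
`ρ < 1/2 − φ_d(∞)` (`= 3/8, 1/32, 1/128, …` at ω₂ = γ = 1): for `d ≥ 2` essentially every rung `ρ > 0` excludes the phonon gas. [piece · peeled door] -/
def PeeledBlockLawAt (ω₂ lam β γ T ρ : ℝ) (d L₀ : ℕ) : Prop :=
  ∃ N₂ : ℕ, ∀ u v : ℕ, N₂ ≤ u → N₂ ≤ v → ∀ (_hu : d + 1 ≤ u) (_hv : d + 1 ≤ v), ∀ ε : ℝ, 0 < ε →
    ∃ δ₀ : ℝ, 0 < δ₀ ∧ ∀ δ : ℝ, 0 < δ → δ < δ₀ →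
      ∀ μ : Measure (PhaseSpace (u + L₀ + v)),
        (pinnedChain ω₂ lam β γ).IsSteadyState (u + L₀ + v) (T + δ / 2) (T - δ / 2) μ →
          δ * (escapeDeficit ω₂ lam β γ T (u + L₀ + v) * (ρ / escapeDeficit ω₂ lam β γ T u) - ε)
              ≤ ∫ x, x.2 ⟨d, by omega⟩ ^ 2 ∂μ - ∫ x, x.2 ⟨u - 1, by omega⟩ ^ 2 ∂μ ∧
          δ * (escapeDeficit ω₂ lam β γ T (u + L₀ + v) * (ρ / escapeDeficit ω₂ lam β γ T v) - ε)
              ≤ ∫ x, x.2 ⟨u + L₀, by omega⟩ ^ 2 ∂μ - ∫ x, x.2 ⟨u + L₀ + v - 1 - d, by omega⟩ ^ 2 ∂μ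

/-! ## B. The seams: peeling is lossless modulo the contact laws -/

/-- **`NFO_d ∧ PBL(ρ, d) ⟹ RelativeBlockLawAt ρ`** — contact drop (`≥ −εδ/2`) plus internal drop telescope to the door's drop. [this file] -/
theorem relativeBlockLawAt_of_peeled {ω₂ lam β γ T ρ : ℝ} {d L₀ : ℕ}
    (hP : ContactPositivityAt ω₂ lam β γ T d) (hB : PeeledBlockLawAt ω₂ lam β γ T ρ d L₀) :
    RelativeBlockLawAt ω₂ lam β γ T ρ L₀ := by
  obtain ⟨N₂, hP⟩ := hP
  obtain ⟨N₂', hB⟩ := hB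
  refine ⟨max (max N₂ N₂') (d + 1), fun u v hu hv _hu _hv ε hε => ?_⟩
  have huN : N₂ ≤ u := le_trans (le_trans (le_max_left _ _) (le_max_left _ _)) hu
  have huN' : N₂' ≤ u := le_trans (le_trans (le_max_right _ _) (le_max_left _ _)) hu
  have hvN' : N₂' ≤ v := le_trans (le_trans (le_max_right _ _) (le_max_left _ _)) hv
  have hud : d + 1 ≤ u := le_trans (le_max_right _ _) hu
  have hvd : d + 1 ≤ v := le_trans (le_max_right _ _) hv
  have hε2 : 0 < ε / 2 := by positivity
  obtain ⟨δ₁, hδ₁, h1⟩ := hP (u + L₀ + v) (le_trans huN (by omega)) (by omega) (ε / 2) hε2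
  obtain ⟨δ₂, hδ₂, h2⟩ := hB u v huN' hvN' hud hvd (ε / 2) hε2
  refine ⟨min δ₁ δ₂, lt_min hδ₁ hδ₂, fun δ hδ hδlt μ hμ => ?_⟩
  obtain ⟨hl1, hr1⟩ := h1 δ hδ (lt_of_lt_of_le hδlt (min_le_left _ _)) μ hμ
  obtain ⟨hl2, hr2⟩ := h2 δ hδ (lt_of_lt_of_le hδlt (min_le_right _ _)) μ hμ
  constructor
  · have e : δ * (escapeDeficit ω₂ lam β γ T (u + L₀ + v) * (ρ / escapeDeficit ω₂ lam β γ T u) - ε)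
        = -(δ * (ε / 2))
          + δ * (escapeDeficit ω₂ lam β γ T (u + L₀ + v) * (ρ / escapeDeficit ω₂ lam β γ T u) - ε / 2) := by ring
    rw [e]
    linarith
  · have e : δ * (escapeDeficit ω₂ lam β γ T (u + L₀ + v) * (ρ / escapeDeficit ω₂ lam β γ T v) - ε)
        = δ * (escapeDeficit ω₂ lam β γ T (u + L₀ + v) * (ρ / escapeDeficit ω₂ lam β γ T v) - ε / 2)
          + -(δ * (ε / 2)) := by ring
    rw [e]
    linarith

/-- Smaller ratio = WEAKER peeled law. [folklore] -/
theorem peeledBlockLawAt_anti {ω₂ lam β γ T ρ ρ' : ℝ} {d L₀ : ℕ} (hω : 0 < ω₂) (hl : 0 < lam) (hβ : 0 < β) (hγ : 0 < γ)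
    (hT : 0 < T) (hρρ' : ρ ≤ ρ') (h : PeeledBlockLawAt ω₂ lam β γ T ρ' d L₀) : PeeledBlockLawAt ω₂ lam β γ T ρ d L₀ := by
  obtain ⟨N₂, h⟩ := h
  refine ⟨max N₂ 2, fun u v hu hv hu1 hv1 ε hε => ?_⟩
  obtain ⟨δ₀, hδ₀, h'⟩ := h u v (le_trans (le_max_left _ _) hu) (le_trans (le_max_left _ _) hv) hu1 hv1 ε hε
  refine ⟨δ₀, hδ₀, fun δ hδ hδδ₀ μ hμ => ?_⟩
  obtain ⟨hleft, hright⟩ := h' δ hδ hδδ₀ μ hμ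
  have hEN : 0 ≤ escapeDeficit ω₂ lam β γ T (u + L₀ + v) :=
    (escapeDeficit_pos hω hl hβ hγ hT (by have := le_trans (le_max_right N₂ 2) hu; omega)).le
  have hEu : 0 < escapeDeficit ω₂ lam β γ T u := escapeDeficit_pos hω hl hβ hγ hT (le_trans (le_max_right _ _) hu)
  have hEv : 0 < escapeDeficit ω₂ lam β γ T v := escapeDeficit_pos hω hl hβ hγ hT (le_trans (le_max_right _ _) hv)
  have hmu : ρ / escapeDeficit ω₂ lam β γ T u ≤ ρ' / escapeDeficit ω₂ lam β γ T u :=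
    div_le_div_of_nonneg_right hρρ' hEu.le
  have hmv : ρ / escapeDeficit ω₂ lam β γ T v ≤ ρ' / escapeDeficit ω₂ lam β γ T v :=
    div_le_div_of_nonneg_right hρρ' hEv.le
  constructor
  · refine le_trans ?_ hleft
    apply mul_le_mul_of_nonneg_left _ hδ.le
    linarith [mul_le_mul_of_nonneg_left hmu hEN]
  · refine le_trans ?_ hright
    apply mul_le_mul_of_nonneg_left _ hδ.le
    linarith [mul_le_mul_of_nonneg_left hmv hEN]

/-- **The converse modulo the contact share: `RelativeBlockLawAt ρ ∧ CS_d(C) ∧ (E_n → 0) ⟹ PBL(ρ', d)` for every `ρ' < ρ`** — internal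
drop = door's drop − contact-region drop `≥ δ·(E_N(ρ/E_u − C) − ε) ≥ δ·(E_N·ρ'/E_u − ε)` once `C·E_u ≤ ρ − ρ'` (large `u`).  With
`relativeBlockLawAt_of_peeled`: peeling a fixed depth is LOSSLESS up to the ratio slack — the door's locality content is ATOMIC along the
depth axis. [this file] -/
theorem peeled_of_relativeBlockLawAt {ω₂ lam β γ T ρ ρ' C : ℝ} {d L₀ : ℕ} (hω : 0 < ω₂) (hl : 0 < lam) (hβ : 0 < β)
    (hγ : 0 < γ) (hT : 0 < T) (hρ' : ρ' < ρ) (hR : RelativeBlockLawAt ω₂ lam β γ T ρ L₀)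
    (hS : ContactShareAt ω₂ lam β γ T C d) (hV : Tendsto (fun n : ℕ => escapeDeficit ω₂ lam β γ T n) atTop (𝓝 0)) :
    PeeledBlockLawAt ω₂ lam β γ T ρ' d L₀ := by
  obtain ⟨N₂, hR⟩ := hR
  obtain ⟨N₂', hS⟩ := hS
  -- a threshold beyond which `C · E_n ≤ ρ − ρ'`
  obtain ⟨N₁, hN₁⟩ : ∃ N₁ : ℕ, ∀ n : ℕ, N₁ ≤ n → 2 ≤ n → C * escapeDeficit ω₂ lam β γ T n ≤ ρ - ρ' := by
    rcases le_or_gt C 0 with hC | hC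
    · exact ⟨0, fun n _ hn => le_trans (mul_nonpos_of_nonpos_of_nonneg hC (escapeDeficit_pos hω hl hβ hγ hT hn).le)
        (by linarith)⟩
    · have hη : 0 < (ρ - ρ') / C := div_pos (by linarith) hC
      obtain ⟨N₁, hN₁⟩ := eventually_atTop.1 (hV.eventually (Iic_mem_nhds hη))
      refine ⟨N₁, fun n hn _ => ?_⟩
      have h : escapeDeficit ω₂ lam β γ T n ≤ (ρ - ρ') / C := hN₁ n hn
      rw [le_div_iff₀ hC] at h
      linarith [mul_comm C (escapeDeficit ω₂ lam β γ T n)]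
  refine ⟨max (max N₂ N₂') (max N₁ (d + 2)), fun u v hu hv hud hvd ε hε => ?_⟩
  have huN : N₂ ≤ u := le_trans (le_trans (le_max_left _ _) (le_max_left _ _)) hu
  have hvN : N₂ ≤ v := le_trans (le_trans (le_max_left _ _) (le_max_left _ _)) hv
  have huN' : N₂' ≤ u := le_trans (le_trans (le_max_right _ _) (le_max_left _ _)) hu
  have hu1 : N₁ ≤ u := le_trans (le_trans (le_max_left _ _) (le_max_right _ _)) hu
  have hv1 : N₁ ≤ v := le_trans (le_trans (le_max_left _ _) (le_max_right _ _)) hv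
  have hu2 : d + 2 ≤ u := le_trans (le_trans (le_max_right _ _) (le_max_right _ _)) hu
  have hv2 : d + 2 ≤ v := le_trans (le_trans (le_max_right _ _) (le_max_right _ _)) hv
  have hε2 : 0 < ε / 2 := by positivity
  obtain ⟨δ₁, hδ₁, h1⟩ := hR u v huN hvN (by omega) (by omega) (ε / 2) hε2
  obtain ⟨δ₂, hδ₂, h2⟩ := hS (u + L₀ + v) (le_trans huN' (by omega)) (by omega) (ε / 2) hε2
  refine ⟨min δ₁ δ₂, lt_min hδ₁ hδ₂, fun δ hδ hδlt μ hμ => ?_⟩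
  obtain ⟨hl1, hr1⟩ := h1 δ hδ (lt_of_lt_of_le hδlt (min_le_left _ _)) μ hμ
  obtain ⟨hl2, hr2⟩ := h2 δ hδ (lt_of_lt_of_le hδlt (min_le_right _ _)) μ hμ
  set EN := escapeDeficit ω₂ lam β γ T (u + L₀ + v) with hEN_def
  set Eu := escapeDeficit ω₂ lam β γ T u with hEu_def
  set Ev := escapeDeficit ω₂ lam β γ T v with hEv_def
  have hEN : 0 ≤ EN := (escapeDeficit_pos hω hl hβ hγ hT (by omega)).le
  have hEu : 0 < Eu := escapeDeficit_pos hω hl hβ hγ hT (by omega)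
  have hEv : 0 < Ev := escapeDeficit_pos hω hl hβ hγ hT (by omega)
  have hCu : C ≤ (ρ - ρ') / Eu := by rw [le_div_iff₀ hEu]; exact hN₁ u hu1 (by omega)
  have hCv : C ≤ (ρ - ρ') / Ev := by rw [le_div_iff₀ hEv]; exact hN₁ v hv1 (by omega)
  have keyu : EN * (ρ' / Eu) ≤ EN * (ρ / Eu) - C * EN := by
    have h0 : 0 ≤ EN * ((ρ - ρ') / Eu - C) := mul_nonneg hEN (sub_nonneg.2 hCu)
    have e : EN * ((ρ - ρ') / Eu - C) = EN * (ρ / Eu) - C * EN - EN * (ρ' / Eu) := by ring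
    linarith [e ▸ h0]
  have keyv : EN * (ρ' / Ev) ≤ EN * (ρ / Ev) - C * EN := by
    have h0 : 0 ≤ EN * ((ρ - ρ') / Ev - C) := mul_nonneg hEN (sub_nonneg.2 hCv)
    have e : EN * ((ρ - ρ') / Ev - C) = EN * (ρ / Ev) - C * EN - EN * (ρ' / Ev) := by ring
    linarith [e ▸ h0]
  constructor
  · have step : δ * (EN * (ρ' / Eu) - ε) ≤ δ * (EN * (ρ / Eu) - ε / 2) - δ * (C * EN + ε / 2) := by
      have e : δ * (EN * (ρ / Eu) - ε / 2) - δ * (C * EN + ε / 2) = δ * (EN * (ρ / Eu) - C * EN - ε) := by ring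
      rw [e]
      exact mul_le_mul_of_nonneg_left (by linarith) hδ.le
    linarith
  · have step : δ * (EN * (ρ' / Ev) - ε) ≤ δ * (EN * (ρ / Ev) - ε / 2) - δ * (C * EN + ε / 2) := by
      have e : δ * (EN * (ρ / Ev) - ε / 2) - δ * (C * EN + ε / 2) = δ * (EN * (ρ / Ev) - C * EN - ε) := by ring
      rw [e]
      exact mul_le_mul_of_nonneg_left (by linarith) hδ.le
    linarith

/-! ## C. Global laws and the frames by name -/

/-- **Contact positivity at depth `d + 1`** (global): for all parameters and `T > 0`, `ContactPositivityAt … d`. Depth 1 is a theorem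
(file 17b `contactPositivity_zero`). [piece · positivity] -/
def ContactPositivity (d : ℕ) : Prop :=
  ∀ ω₂ lam β γ : ℝ, 0 < ω₂ → 0 < lam → 0 < β → 0 < γ → ∀ T : ℝ, 0 < T → ContactPositivityAt ω₂ lam β γ T d

/-- **Contact share at depth `d + 1`** (global): for all parameters and `T > 0` there is `C` with `ContactShareAt … C d`. [piece · local share] -/
def ContactShare (d : ℕ) : Prop :=
  ∀ ω₂ lam β γ : ℝ, 0 < ω₂ → 0 < lam → 0 < β → 0 < γ → ∀ T : ℝ, 0 < T → ∃ C : ℝ, ContactShareAt ω₂ lam β γ T C d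

/-- **Peeled locality law** with ratio `ρ` at depth `d + 1` (global): for all parameters and `T > 0` there are `b`, `L₀` with
`PeeledBlockLawAt … ρ d L₀` and file 5's soft `BufferPassivityAt … b L₀` — `RelativeLocalityLaw ρ` with the contact regions peeled.
[piece · peeled door] -/
def PeeledLocalityLaw (ρ : ℝ) (d : ℕ) : Prop :=
  ∀ ω₂ lam β γ : ℝ, 0 < ω₂ → 0 < lam → 0 < β → 0 < γ → ∀ T : ℝ, 0 < T →
    ∃ b : ℝ, ∃ L₀ : ℕ, PeeledBlockLawAt ω₂ lam β γ T ρ d L₀ ∧ BufferPassivityAt ω₂ lam β γ T b L₀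

/-- **`ContactPositivity d ∧ PeeledLocalityLaw ρ d ⟹ RelativeLocalityLaw ρ`.** [this file · frame] -/
theorem relativeLocalityLaw_of_peeled {ρ : ℝ} {d : ℕ} (hP : ContactPositivity d) (hL : PeeledLocalityLaw ρ d) :
    RelativeLocalityLaw ρ := by
  intro ω₂ lam β γ hω hl hβ hγ T hT
  obtain ⟨b, L₀, hB, hBP⟩ := hL ω₂ lam β γ hω hl hβ hγ T hT
  exact ⟨b, L₀, relativeBlockLawAt_of_peeled (hP ω₂ lam β γ hω hl hβ hγ T hT) hB, hBP⟩

/-- **Converse frame: `RelativeLocalityLaw ρ ∧ ContactShare d ∧ EscapeVanishing ⟹ PeeledLocalityLaw ρ' d`** (`ρ' < ρ`). [this file · frame] -/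
theorem peeledLocalityLaw_of_relativeLocalityLaw {ρ ρ' : ℝ} {d : ℕ} (hρ' : ρ' < ρ) (hL : RelativeLocalityLaw ρ)
    (hS : ContactShare d) (hV : EscapeVanishing) : PeeledLocalityLaw ρ' d := by
  intro ω₂ lam β γ hω hl hβ hγ T hT
  obtain ⟨b, L₀, hR, hBP⟩ := hL ω₂ lam β γ hω hl hβ hγ T hT
  obtain ⟨C, hC⟩ := hS ω₂ lam β γ hω hl hβ hγ T hT
  exact ⟨b, L₀, peeled_of_relativeBlockLawAt hω hl hβ hγ hT hρ' hR hC (hV ω₂ lam β γ hω hl hβ hγ T hT), hBP⟩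

/-- Smaller ratio = WEAKER peeled locality law. [folklore] -/
theorem peeledLocalityLaw_anti {ρ ρ' : ℝ} {d : ℕ} (hρρ' : ρ ≤ ρ') : PeeledLocalityLaw ρ' d → PeeledLocalityLaw ρ d := by
  intro h ω₂ lam β γ hω hl hβ hγ T hT
  obtain ⟨b, L₀, hB, hBP⟩ := h ω₂ lam β γ hω hl hβ hγ T hT
  exact ⟨b, L₀, peeledBlockLawAt_anti hω hl hβ hγ hT hρρ' hB, hBP⟩

/-- **THE PEELED DOOR: `(∀ ρ < 1, PeeledLocalityLaw ρ d) ∧ ContactPositivity d ∧ EscapeInfZero ⟹ AsymptoticSeriesLaw`.** [frame] -/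
theorem asymptoticSeriesLaw_of_peeled_of_escapeInfZero {d : ℕ} (hL : ∀ ρ : ℝ, ρ < 1 → PeeledLocalityLaw ρ d)
    (hP : ContactPositivity d) (hI : EscapeInfZero) : AsymptoticSeriesLaw :=
  asymptoticSeriesLaw_of_relativeLocality_of_escapeInfZero (fun ρ hρ => relativeLocalityLaw_of_peeled hP (hL ρ hρ)) hI

/-- **The four-piece node, by name: `(∀ ρ < 1, PeeledLocalityLaw ρ d) ∧ ContactPositivity d ∧ EscapeInfZero ∧ SubOhmicBootstrap ⟹
BoundedResponse` (11071).** [frame] -/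
theorem boundedResponse_of_peeled_of_escapeInfZero_of_subOhmicBootstrap {d : ℕ}
    (hL : ∀ ρ : ℝ, ρ < 1 → PeeledLocalityLaw ρ d) (hP : ContactPositivity d) (hI : EscapeInfZero)
    (hB : SubOhmicBootstrap) : BoundedResponse :=
  boundedResponse_of_relativeLocality_of_escapeInfZero_of_subOhmicBootstrap
    (fun ρ hρ => relativeLocalityLaw_of_peeled hP (hL ρ hρ)) hI hB

end EscapeGrading

end Summit.AtomisticToContinuum.FouriersLaw.Theorems.SubdiffusiveBondHeat

end
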